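import Summits.QuantumFields.YangMills.Theorems.BalabanUVNodesN15KingModelBlockCovarianceContinuumNE2Unit

/-!
# BalabanUVNodes ∕ N15 — THE KING-MODEL RUNG (PART Ϡ-o): THE TOP PIECE `G^η_{(K)}` AT BLOCK BASE POINTS HAS A `K → ∞` PARTNER — existence by the geometric η-rate
# (Prop. 3.9 for `G_{(K)}`, p. 675), the (3.73)-shape rate `C e^{−δ|b−b′|}L^{−γK∕2}` AGAINST THE PARTNER, and the node statement `N15At` INHABITED IN ALL THREE LAYERS BY
# `(level K, level ∞)` pairs: operator and site layers by the top piece, unit layer by `((Δ^{(K)})⁻¹, C^{(∞)})` of parts Ϡ-e∕Ϡ-i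
# (Track A, DAG node N15 = NE2; FAN-OUT v1.1 §N15 s3 «KING-MODEL RUNG … NE2's analogue DECIDED in the model»)

HONEST FRAMING.  Count-neutral (cell `pub-ymgap`, seat `pub-ymgap-dag-n15-e` g32; `--supports stmt-QuantumFields-27366 --as helper` = K3⁸
`SpineGivenEndpointR13SepCoPHV`).  TEMPLATE LITERATURE: C. King, *The U(1) Higgs model. I. The continuum limit*, Commun. Math. Phys. **102** (1986) 649–677
[King1986] — KING's OWN `A = 0` MODEL: the top-scale piece `G^η_{(K)}` of (2.17) p. 653 ∕ (4.44) p. 675 read at the base points of unit blocks (the rung's g0 `topPieceBase`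
∕ `topPieceStep`, its two-spacing rate `topPiece_step_le` = p. 675 «Proposition 3.9 holds for G^η_{(K)}»), the typed layers `T4EtaRate.EtaRateIneqSite` ∕
`EtaRateIneq342` ∕ `NE2PlusSite` ∕ `NE2PlusOperator` ([B9] Thm 3.1 (3.42) p. 397 + Thm 3.2 (3.48) p. 398 as QUANTIFIER TEMPLATES) and `YMDAG.UVSplit.N15At`.  NOT
Bałaban's objects; NOT `S_N15 RRec`; NOT a node discharge (N15 is booked through n15-a's knit, untouched here); nothing continuum-Yang–Mills ∕ ℝ⁴ ∕ OS ∕ mass-gap ∕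
Clay.  0 `sorry`; standard axioms; plumbing `def`s (`topPieceSeq`, `topPieceLim`, `topPieceLimStep`, `topPieceLimSite`, `topPieceLimOp`, `kingVolCarriersLimAll`).

THE MATHEMATICS.  The g0 step bound `|G_{(K+1)}(L^{K+1}b, L^{K+1}b′) − G_{(K)}(L^Kb, L^Kb′)| ≤ C e^{−δ|b−b′|_T}(L^{−γ∕2})^K` (ONE `(C, δ)` for all volumes `2L^m` and `K ≥ 1`)
is geometric, so on every King volume the sequence `K ↦ G_{(K)}(L^Kb, L^Kb′)` is Cauchy (Mathlib `cauchySeq_of_le_geometric` on the shifted sequence), has a limit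
`G_{(∞)}(b, b′) := topPieceLim` (`ℝ` complete; `CauchySeq.tendsto_limUnder`) and `|G_{(K)} − G_{(∞)}| ≤ C∕(1 − L^{−γ∕2})·e^{−δ|b−b′|_T}(L^{−γ∕2})^K`
(`dist_le_of_le_geometric_of_tendsto`).  HONEST: unlike `C^{(∞)}` (part Ϡ-e) this partner is NOT given in closed form — the top piece at fine base points is a
fine-lattice Green's function at points, whose continuum value is only conditionally convergent in `d + 1 ≥ 2`; existence + rate is what the η-rate telescoping gives
(as in parts Β-e∕Β-h for graph kernels).  The kernel bound has exactly the shape consumed by the g0 layer lemmas, so `EtaRateIneqSite` ∕ `EtaRateIneq342` ∕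
`NE2PlusSite` ∕ `NE2PlusOperator` hold for the `(K, ∞)` difference kernel with constants `(C∕(1−θ), δ, γ∕2)`, and with part Ϡ-i's unit layer the node statement
`N15At` is inhabited by `(K, ∞)` pairs in ALL THREE layers (`d + 1 = 4`).

WHAT THIS FILE PROVES (kernel).  §1 `topPieceSeq`, `topPieceBase_congrN`, ★ `topPieceSeq_succ_sub_le` (the g0 step bound along the sequence), ★★ `cauchySeq_topPieceSeq`,
`topPieceLim`, ★★ **`tendsto_topPieceSeq`** (`G_{(K)}(L^Kb, L^Kb′) → G_{(∞)}(b, b′)`), ★★★ **`topPieceLim_rate`** (`|G_{(K)} − G_{(∞)}| ≤ C′e^{−δ|b−b′|_T}(L^{−γ∕2})^K`, one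
`(C′, δ)` for all volumes, `K ≥ 1`).  §2 `topPieceLimStep∕Site∕Op`, ★★ `etaRateIneqSite_topPieceLim`, ★★★ **`ne2PlusSite_topPieceLim`**, `ne2ZeroSite_topPieceLim`,
★★★ **`ne2PlusOperator_topPieceLim`**, `ne2ZeroOperator_topPieceLim`.  §3 `kingVolCarriersLimAll`, ★★★ **`n15At_kingModelRung_limAll`** (`N15At` with all three layers
read against `K = ∞` partners; `d + 1 = 4`), `kingVolCarriersLimAll_index_nonempty`.

HONEST SCOPE.  King's `A = 0` model on the cubic unit tori `2L^m`, odd `L ≥ 3`, `a, m² > 0`, `0 < γ ≤ 1`; one-point backgrounds; the partner `G_{(∞)}` is a `limUnder`,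
not a closed form.  N15 untouched; counts unmoved.  Locators: [King1986] (2.17) p.653, Prop. 3.9 (3.73) p.665, (4.44)–(4.45) p.675, Thm 2.1 (2.22) p.654;
[Balaban1985BackgroundPropagators] Thm 3.1 (3.42) p.397, Thm 3.2 (3.48) p.398.
-/

noncomputable section

namespace Summit.QuantumFields.YangMills.BalabanUVNodes.N15KingModelRung

open Real Finset Filter Topology
open Literature.MathematicalPhysics.QuantumFieldTheory.Balaban1983to89
open Literature.MathematicalPhysics.QuantumFieldTheory.Balaban1983to89.T4EtaRate (PairedInstance EtaRateIneq342 EtaRateIneqSite NE2PlusOperator NE2PlusSite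
  NE2PlusUnit NE2ZeroOperator ne2Zero_of_ne2Plus rateFactor)
open Literature.MathematicalPhysics.QuantumFieldTheory.Balaban1983to89.T4EtaRateSiteOfRatePair (NE2ZeroSite)
open Literature.MathematicalPhysics.QuantumFieldTheory.Balaban1983to89.T4EtaRateOperatorTorus (torusOpGeo torusOpInstance B0op B0op_pos torusOpGeo_len
  torusOpGeo_dist rateFactor_torusOpGeo)
open Literature.MathematicalPhysics.QuantumFieldTheory.Balaban1983to89.T4EtaRateDefectSite (pt9Bg)
open Literature.MathematicalPhysics.QuantumFieldTheory.Balaban1983to89.B5Prop11Plancherel (Tor fine)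
open Literature.MathematicalPhysics.QuantumFieldTheory.King1986 (aK)
open Literature.MathematicalPhysics.QuantumFieldTheory.King1986.Torus (tdistT)
open Summit.QuantumFields.YangMills.BalabanUVNodes.N18KingModel (kingTheta_pos kingTheta_lt_one)
open YMDAG.UVSplit (NE2Carriers N15At)

variable {d : ℕ}

/-! ## §1 The sequence `K ↦ G_{(K)}(L^Kb, L^Kb′)`, its Cauchy property, the partner and the rate -/

section Partner

variable (L : ℕ) [NeZero L]

/-- THE SEQUENCE OF TOP PIECES AT BASE POINTS on the King volume of index `j` (depends on `j` through the volume `2L^m` only): `K ↦ G^η_{(K)}(L^Kb, L^Kb′)`.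
[cite: King1986, (2.17) p.653, (4.44) p.675] -/
def topPieceSeq (a m2 : ℝ) (j : KingVolIndex d) (b b' : Tor (kingVol L j)) (K : ℕ) : ℝ :=
  haveI := kingVol_neZero L j
  topPieceBase L (L ^ K) (kingVol L j) a m2 K b b'

omit [NeZero L] in
/-- `topPieceBase` does not depend on the spelling of the fine level (`L^{K+1}` versus `L·L^K`). [cite: King1986, (2.17) p.653] -/
theorem topPieceBase_congrN {N N' : ℕ} [NeZero N] [NeZero N'] (h : N = N') (M : Fin (d + 1) → ℕ) [∀ μ, NeZero (M μ)] (a m2 : ℝ) (K : ℕ) (b b' : Tor M) :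
    topPieceBase L N M a m2 K b b' = topPieceBase L N' M a m2 K b b' := by
  subst h
  rfl

/-- ★ THE g0 STEP BOUND ALONG THE SEQUENCE (odd `L ≥ 3`, `a, m² > 0`, `0 < γ ≤ 1`): ONE `(C, δ)` such that for every index, all sites and every `K ≥ 1`,
`|topPieceSeq (K+1) − topPieceSeq K| ≤ C·e^{−δ|b−b′|_T}·(L^{−γ∕2})^K` — `topPiece_step_le` at the index `⟨m, K, …⟩` of the same volume (definitional transport).
[cite: King1986, Prop. 3.9 (3.73) p.665, p.675] -/
theorem topPieceSeq_succ_sub_le (hLodd : Odd L) (hL : 2 ≤ L) {a m2 : ℝ} (ha : 0 < a) (hm : 0 < m2) {γ : ℝ} (hγ0 : 0 < γ) (hγ1 : γ ≤ 1) :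
    ∃ C δ : ℝ, 0 < C ∧ 0 < δ ∧ ∀ (j : KingVolIndex d) (b b' : Tor (kingVol L j)) (K : ℕ), 1 ≤ K →
      haveI := kingVol_neZero L j
      |topPieceSeq L a m2 j b b' (K + 1) - topPieceSeq L a m2 j b b' K|
        ≤ C * Real.exp (-(δ * tdistT (kingVol L j) b b')) * (((L : ℝ) ^ (-(γ / 2))) ^ K) := by
  obtain ⟨C, δ, hC, hδ, H⟩ := topPiece_step_le (d := d) L hLodd hL ha hm hγ0 hγ1
  refine ⟨C, δ, hC, hδ, fun j b b' K hK => ?_⟩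
  haveI := kingVol_neZero L j
  haveI : NeZero (L ^ 1 * L ^ K) := ⟨mul_ne_zero (pow_ne_zero _ (NeZero.ne L)) (pow_ne_zero _ (NeZero.ne L))⟩
  have h := H ⟨j.m, K, hK, j.Msz, j.one_le_Msz⟩ b b'
  have e : topPieceSeq L a m2 j b b' (K + 1) - topPieceSeq L a m2 j b b' K = topPieceStep L a m2 ⟨j.m, K, hK, j.Msz, j.one_le_Msz⟩ b b' := by
    show topPieceBase L (L ^ (K + 1)) (kingVol L j) a m2 (K + 1) b b' - topPieceBase L (L ^ K) (kingVol L j) a m2 K b b'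
      = topPieceBase L (L ^ 1 * L ^ K) (kingVol L j) a m2 (K + 1) b b' - topPieceBase L (L ^ K) (kingVol L j) a m2 K b b'
    rw [topPieceBase_congrN L (show L ^ (K + 1) = L ^ 1 * L ^ K by ring)]
  rw [e]
  exact h

/-- ★★ THE SEQUENCE IS CAUCHY on every King volume (odd `L ≥ 3`, `a, m² > 0`). [cite: King1986, Prop. 3.9 (3.73) p.665, p.675, Thm 2.1 (2.22) p.654] -/
theorem cauchySeq_topPieceSeq (hLodd : Odd L) (hL : 2 ≤ L) {a m2 : ℝ} (ha : 0 < a) (hm : 0 < m2) (j : KingVolIndex d) (b b' : Tor (kingVol L j)) :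
    CauchySeq (topPieceSeq L a m2 j b b') := by
  haveI := kingVol_neZero L j
  obtain ⟨C, δ, hC, hδ, H⟩ := topPieceSeq_succ_sub_le L hLodd hL ha hm one_pos le_rfl
  set θ : ℝ := (L : ℝ) ^ (-((1 : ℝ) / 2)) with hθ
  have hθ1 : θ < 1 := kingTheta_lt_one hL (by norm_num)
  set E : ℝ := Real.exp (-(δ * tdistT (kingVol L j) b b')) with hE
  -- the shifted sequence is geometric-Cauchy
  have hshift : CauchySeq (fun n => topPieceSeq L a m2 j b b' (n + 1)) := by
    refine cauchySeq_of_le_geometric θ (C * E * θ) hθ1 fun n => ?_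
    rw [Real.dist_eq, abs_sub_comm]
    have h := H j b b' (n + 1) (by omega)
    calc _ ≤ C * E * θ ^ (n + 1) := h
      _ = C * E * θ * θ ^ n := by rw [pow_succ]; ring
  exact (cauchySeq_shift 1).mp hshift   -- `CauchySeq (fun n => u (n + k)) ↔ CauchySeq u`

/-- THE `K → ∞` PARTNER of the top piece at base points: `G_{(∞)}(b, b′) := lim_K G^η_{(K)}(L^Kb, L^Kb′)` (a `limUnder`; no closed form claimed). [cite: King1986, Thm 2.1 (2.22) p.654, (4.44)–(4.45) p.675] -/
def topPieceLim (a m2 : ℝ) (j : KingVolIndex d) (b b' : Tor (kingVol L j)) : ℝ :=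
  limUnder atTop (topPieceSeq L a m2 j b b')

/-- ★★ **THE TOP PIECE CONVERGES TO ITS PARTNER**: `G^η_{(K)}(L^Kb, L^Kb′) → G_{(∞)}(b, b′)` as `K → ∞` (odd `L ≥ 3`, `a, m² > 0`, every King volume, all sites).
[cite: King1986, Thm 2.1 (2.22) p.654, (4.44)–(4.45) p.675] -/
theorem tendsto_topPieceSeq (hLodd : Odd L) (hL : 2 ≤ L) {a m2 : ℝ} (ha : 0 < a) (hm : 0 < m2) (j : KingVolIndex d) (b b' : Tor (kingVol L j)) :
    Tendsto (topPieceSeq L a m2 j b b') atTop (𝓝 (topPieceLim L a m2 j b b')) :=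
  (cauchySeq_topPieceSeq L hLodd hL ha hm j b b').tendsto_limUnder

/-- ★★★ **THE (3.73)-SHAPE RATE AGAINST THE PARTNER**: for odd `L ≥ 3`, `a, m² > 0`, `0 < γ ≤ 1` there are `C′, δ > 0` with, for EVERY index, all sites and `K ≥ 1`,
`|G^η_{(K)}(L^Kb, L^Kb′) − G_{(∞)}(b, b′)| ≤ C′·e^{−δ|b−b′|_T}·(L^{−γ∕2})^K` (`C′ = C∕(1 − L^{−γ∕2})`). [cite: King1986, Prop. 3.9 (3.73) p.665, p.675] -/
theorem topPieceLim_rate (hLodd : Odd L) (hL : 2 ≤ L) {a m2 : ℝ} (ha : 0 < a) (hm : 0 < m2) {γ : ℝ} (hγ0 : 0 < γ) (hγ1 : γ ≤ 1) :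
    ∃ C δ : ℝ, 0 < C ∧ 0 < δ ∧ ∀ (j : KingVolIndex d) (b b' : Tor (kingVol L j)) (K : ℕ), 1 ≤ K →
      haveI := kingVol_neZero L j
      |topPieceSeq L a m2 j b b' K - topPieceLim L a m2 j b b'|
        ≤ C * Real.exp (-(δ * tdistT (kingVol L j) b b')) * (((L : ℝ) ^ (-(γ / 2))) ^ K) := by
  obtain ⟨C, δ, hC, hδ, H⟩ := topPieceSeq_succ_sub_le L hLodd hL ha hm hγ0 hγ1
  set θ : ℝ := (L : ℝ) ^ (-(γ / 2)) with hθ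
  have hθ0 : 0 < θ := kingTheta_pos (by omega) _
  have hθ1 : θ < 1 := kingTheta_lt_one hL (half_pos hγ0)
  refine ⟨C / (1 - θ), δ, div_pos hC (by linarith), hδ, fun j b b' K hK => ?_⟩
  haveI := kingVol_neZero L j
  set E : ℝ := Real.exp (-(δ * tdistT (kingVol L j) b b')) with hE
  set f : ℕ → ℝ := fun n => topPieceSeq L a m2 j b b' (n + 1) with hf
  have hstep : ∀ n, dist (f n) (f (n + 1)) ≤ C * E * θ * θ ^ n := by
    intro n
    rw [Real.dist_eq, abs_sub_comm]
    have h := H j b b' (n + 1) (by omega)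
    calc _ ≤ C * E * θ ^ (n + 1) := h
      _ = C * E * θ * θ ^ n := by rw [pow_succ]; ring
  have hlim : Tendsto f atTop (𝓝 (topPieceLim L a m2 j b b')) :=
    (tendsto_topPieceSeq L hLodd hL ha hm j b b').comp (tendsto_add_atTop_nat 1)
  have hgeo := dist_le_of_le_geometric_of_tendsto θ (C * E * θ) hθ1 hstep hlim (K - 1)
  have hfK : f (K - 1) = topPieceSeq L a m2 j b b' K := by
    simp only [hf, Nat.sub_add_cancel hK]
  rw [hfK, Real.dist_eq] at hgeo
  have hpow : θ * θ ^ (K - 1) = θ ^ K := by rw [← pow_succ', Nat.sub_add_cancel hK]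
  calc |topPieceSeq L a m2 j b b' K - topPieceLim L a m2 j b b'| ≤ C * E * θ * θ ^ (K - 1) / (1 - θ) := hgeo
    _ = C / (1 - θ) * E * θ ^ K := by rw [← hpow]; ring

end Partner

/-! ## §2 The `(K, ∞)` difference kernel and its layers -/

section Layers

variable (L : ℕ) [NeZero L]

/-- THE `(K, ∞)` DIFFERENCE OF THE TOP PIECE at index `j`: `G^η_{(K)}(L^Kb, L^Kb′) − G_{(∞)}(b, b′)`, `K = j.K`. [cite: King1986, Prop. 3.9 (3.73) p.665 (shape, n = ∞)] -/
def topPieceLimStep (a m2 : ℝ) (j : KingVolIndex d) (b b' : Tor (kingVol L j)) : ℝ :=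
  topPieceSeq L a m2 j b b' j.K - topPieceLim L a m2 j b b'

/-- The `(K, ∞)` difference as a SITE kernel on the King-model family. [cite: Balaban1985BackgroundPropagators, Thm 3.2 (3.48) p.398 (shape)] -/
def topPieceLimSite (a m2 : ℝ) : ∀ j : KingVolIndex d, B9.SiteKernel (kingVolInstance d L j).gc (kingVolInstance d L j).Bf :=
  fun j => ⟨fun _ b b' => topPieceLimStep L a m2 j b b'⟩

/-- The `(K, ∞)` difference as an OPERATOR family (four (3.42) entries) on the King-model family. [cite: Balaban1985BackgroundPropagators, (3.42) p.397 (shape)] -/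
def topPieceLimOp (a m2 : ℝ) : ∀ j : KingVolIndex d, B9.KernelFamily (kingVolInstance d L j).gc (kingVolInstance d L j).Bf :=
  fun j =>
    haveI := kingVol_neZero L j
    opKernelFamily₂ (N := kingVol L j) (topPieceLimStep L a m2 j) (L : ℝ) j.Msz j.K

/-- ★★ THE TYPED SITE INEQUALITY AGAINST THE PARTNER, UNIFORMLY (odd `L ≥ 3`, `a, m² > 0`, `0 < γ ≤ 1`): ONE `(C, δ)` with `EtaRateIneqSite d′ p (topPieceLimSite L a m² j) C δ (γ∕2)`
for EVERY index and background, every `(d′, p)`. [cite: Balaban1985BackgroundPropagators, Thm 3.2 (3.48) p.398 (shape); King1986, Prop. 3.9 (3.73) p.665, p.675] -/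
theorem etaRateIneqSite_topPieceLim (hLodd : Odd L) (hL : 2 ≤ L) {a m2 : ℝ} (ha : 0 < a) (hm : 0 < m2) {γ : ℝ} (hγ0 : 0 < γ) (hγ1 : γ ≤ 1) :
    ∃ C δ : ℝ, 0 < C ∧ 0 < δ ∧ ∀ (j : KingVolIndex d) (U : (kingVolInstance d L j).Bf.Cfg) (d' : ℕ) (p : ℝ),
      EtaRateIneqSite d' p (topPieceLimSite L a m2 j) C δ (γ / 2) U := by
  obtain ⟨C, δ, hC, hδ, H⟩ := topPieceLim_rate (d := d) L hLodd hL ha hm hγ0 hγ1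
  refine ⟨C, δ, hC, hδ, fun j U d' p y y' => ?_⟩
  haveI := kingVol_neZero L j
  have hL0 : (0 : ℝ) < L := by exact_mod_cast Nat.pos_of_ne_zero (NeZero.ne L)
  show |topPieceLimStep L a m2 j y y'| ≤
    C * (torusOpGeo d (L : ℝ) j.Msz j.K (kingVol L j)).len y ^ (-p) *
      (torusOpGeo d (L : ℝ) j.Msz j.K (kingVol L j)).len y' ^ (-(d' : ℝ)) *
      Real.exp (-(δ * (torusOpGeo d (L : ℝ) j.Msz j.K (kingVol L j)).dist y y')) *
      max (rateFactor (torusOpGeo d (L : ℝ) j.Msz j.K (kingVol L j)) (γ / 2) y)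
        (rateFactor (torusOpGeo d (L : ℝ) j.Msz j.K (kingVol L j)) (γ / 2) y')
  rw [torusOpGeo_len _ hL0.ne', torusOpGeo_len _ hL0.ne', Real.one_rpow, Real.one_rpow, mul_one, mul_one,
    rateFactor_torusOpGeo _ hL0, rateFactor_torusOpGeo _ hL0, max_self, torusOpGeo_dist, ← tdistT_eq_dist]
  exact H j y y' j.K j.one_le_K

/-- ★★★ **`NE2PlusSite` IS INHABITED BY THE TOP PIECE AGAINST ITS `K = ∞` PARTNER, HYPOTHESIS-FREE** (odd `L ≥ 3`, `a, m² > 0`, `0 < γ ≤ 1`; every `d′`, `p`, `c35`).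
[cite: Balaban1985BackgroundPropagators, Thm 3.2 (3.48) p.398 + Thm 3.14 pp.426–427 (template); King1986, Prop. 3.9 (3.73) p.665, p.675] -/
theorem ne2PlusSite_topPieceLim (hLodd : Odd L) (hL : 2 ≤ L) {a m2 : ℝ} (ha : 0 < a) (hm : 0 < m2) {γ : ℝ} (hγ0 : 0 < γ) (hγ1 : γ ≤ 1) (d' : ℕ) (p c35 : ℝ) :
    NE2PlusSite d' p c35 (kingVolInstance d L) (topPieceLimSite L a m2) := by
  obtain ⟨C, δ, hC, hδ, H⟩ := etaRateIneqSite_topPieceLim (d := d) L hLodd hL ha hm hγ0 hγ1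
  exact ⟨1, δ, 1, C, γ / 2, one_pos, hδ, one_pos, hC, half_pos hγ0, fun j _ _ _ _ U _ => H j U d' p⟩

/-- `NE2ZeroSite` for the `(K, ∞)` top-piece kernel (every `d′`, `p`). [cite: King1986, Prop. 3.9 (3.73) p.665, p.675] -/
theorem ne2ZeroSite_topPieceLim (hLodd : Odd L) (hL : 2 ≤ L) {a m2 : ℝ} (ha : 0 < a) (hm : 0 < m2) {γ : ℝ} (hγ0 : 0 < γ) (hγ1 : γ ≤ 1) (d' : ℕ) (p : ℝ) :
    NE2ZeroSite d' p (kingVolInstance d L) (topPieceLimSite L a m2) := by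
  obtain ⟨C, δ, hC, hδ, H⟩ := etaRateIneqSite_topPieceLim (d := d) L hLodd hL ha hm hγ0 hγ1
  exact ⟨1, δ, C, γ / 2, one_pos, hδ, hC, half_pos hγ0, fun j _ => H j _ d' p⟩

/-- ★★★ **`NE2PlusOperator` IS INHABITED BY THE TOP PIECE AGAINST ITS `K = ∞` PARTNER, HYPOTHESIS-FREE** (odd `L ≥ 3`, `a, m² > 0`, `0 < γ ≤ 1`; every `c35`): the four (3.42)
entries of the unit-lattice operator of the `(K, ∞)` kernel, constants `(1, δ, 1, B0op d δ C, γ∕2)`, through the g0 two-point readout.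
[cite: Balaban1985BackgroundPropagators, Thm 3.1 (3.42) p.397 (template); King1986, Prop. 3.9 (3.73) p.665, p.675] -/
theorem ne2PlusOperator_topPieceLim (hLodd : Odd L) (hL : 2 ≤ L) {a m2 : ℝ} (ha : 0 < a) (hm : 0 < m2) {γ : ℝ} (hγ0 : 0 < γ) (hγ1 : γ ≤ 1) (c35 : ℝ) :
    NE2PlusOperator c35 (kingVolInstance d L) (topPieceLimOp L a m2) := by
  obtain ⟨C, δ, hC, hδ, H⟩ := topPieceLim_rate (d := d) L hLodd hL ha hm hγ0 hγ1
  have hL0 : (0 : ℝ) < L := by exact_mod_cast Nat.pos_of_ne_zero (NeZero.ne L)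
  refine ⟨1, δ, 1, B0op d δ C, γ / 2, one_pos, hδ, one_pos, B0op_pos d δ hC, half_pos hγ0, fun j _ _ _ _ U _ => ?_⟩
  haveI := kingVol_neZero L j
  exact etaRateIneq342_of_kernelBound₂ (N := kingVol L j) hL0 j.Msz j.K (fun y z => H j y z j.K j.one_le_K) hδ.le

/-- `NE2ZeroOperator` for the `(K, ∞)` top-piece kernel. [cite: King1986, Props. 3.8–3.9 (3.71)–(3.75) pp.664–665, p.675] -/
theorem ne2ZeroOperator_topPieceLim (hLodd : Odd L) (hL : 2 ≤ L) {a m2 : ℝ} (ha : 0 < a) (hm : 0 < m2) {γ : ℝ} (hγ0 : 0 < γ) (hγ1 : γ ≤ 1) :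
    NE2ZeroOperator (kingVolInstance d L) (topPieceLimOp L a m2) :=
  ne2Zero_of_ne2Plus (c35 := 0) (fun _ _ _ => trivial) (ne2PlusOperator_topPieceLim L hLodd hL ha hm hγ0 hγ1 0)

end Layers

/-! ## §3 `N15At` with all three layers read against `K = ∞` partners -/

section Node

variable (L : ℕ) [NeZero L]

/-- THE KING-MODEL CARRIER BUNDLE WITH ALL THREE LAYERS AGAINST `K = ∞` PARTNERS (`d + 1 = 4`): operator and site layers = the `(K, ∞)` top-piece kernel, unit layer
= part Ϡ-i's `((Δ^{(K)})⁻¹, C^{(∞)})` kernel.  NOT the carriers of record. [cite: King1986, (2.17) p.653, Thm 2.1 (2.22) p.654 (objects)] -/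
def kingVolCarriersLimAll (a m2 c35 p : ℝ) : NE2Carriers where
  I := KingVolIndex 3
  c35 := c35
  p := p
  pi := kingVolInstance 3 L
  Kop := topPieceLimOp L a m2
  Ksite := topPieceLimSite L a m2
  Kunit := blockCovLimUnit L a m2
  inΛ := fun _ _ => True
  unitDist := kingUnitDist L

/-- ★★★ **`N15At` AT THE KING-MODEL CARRIERS WITH EVERY LAYER READ AGAINST ITS `K = ∞` PARTNER, HYPOTHESIS-FREE** (odd `L ≥ 3`, `a, m² > 0`, `0 < γ ≤ 1`, every `c35`,
`p`; `d + 1 = 4`): `NE2PlusOperator ∧ NE2PlusSite 4 p ∧ NE2PlusUnit` for the pairs `(G_{(K)}, G_{(∞)})` (operator, site) and `((Δ^{(K)})⁻¹, C^{(∞)})` (unit) — the node's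
typed statement decided in King's model in the `n = ∞` reading of every η-difference.  NOT `S_N15 RRec`, NOT a discharge. [cite: King1986, Prop. 3.9 (3.73) p.665, p.675, Lemma 4.5 (4.38) p.674, Thm 2.1 (2.22) p.654; Balaban1985BackgroundPropagators, Thm 3.1 p.397 + Thm 3.2 (3.48) p.398 + Thm 3.15 (3.187) p.432 (templates)] -/
theorem n15At_kingModelRung_limAll (hLodd : Odd L) (hL : 2 ≤ L) {a m2 : ℝ} (ha : 0 < a) (hm : 0 < m2) {γ : ℝ} (hγ0 : 0 < γ) (hγ1 : γ ≤ 1) (c35 p : ℝ) :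
    N15At (kingVolCarriersLimAll L a m2 c35 p) :=
  ⟨ne2PlusOperator_topPieceLim (d := 3) L hLodd hL ha hm hγ0 hγ1 c35, ne2PlusSite_topPieceLim (d := 3) L hLodd hL ha hm hγ0 hγ1 4 p c35,
    ne2PlusUnit_blockCovLim (d := 3) L hLodd hL ha hm c35⟩

/-- The bundle's index type is inhabited (not the empty-index trap). [folklore] -/
theorem kingVolCarriersLimAll_index_nonempty (a m2 c35 p : ℝ) : Nonempty (kingVolCarriersLimAll L a m2 c35 p).I :=
  kingVolIndex_nonempty 3

end Node

end Summit.QuantumFields.YangMills.BalabanUVNodes.N15KingModelRung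

end
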